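import Summits.QuantumFields.YangMills.Theorems.BalabanUVNodesK0V19Defs
import Summits.QuantumFields.YangMills.Theorems.BalabanUVNodesK2NamedJetsRunRemAt
import Summits.QuantumFields.YangMills.Theorems.BalabanUVNodesN22KernelsBetaHistLipschitz
import Summits.QuantumFields.YangMills.Theorems.BalabanUVNodesK0Stub3RunwiseFace

/-!
# K0⁷ — THE RUN FACE 3ᴿ AND THE BOX SOCKET 3ᴬ′ OF STUB 3 COINCIDE MODULO THE K3∕N22 KERNEL LETTERS: (i) the run letter forces in-window runs of every length;
# (ii) runs + history-Lipschitz moduli with summable rows ⟹ the sign-free BOX; (iii) at the record ∕ A1's witness BY NAME from N22's kernel NE9 (fading memory) and the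
# (D4) letter `KernelDecayOfRecord₁₃` — the CONVERSE of «3ᴬ′ ⟹ 3ᴿ», (j, c)-generic

Cell `pub-ymgap`, width seat `pub-ymgap-k0-s3-w1` (g0; director-ym R399 (3a) ∕ №207; HUMAN RULING D-0154; this seat's CLAIM-3, bus `[K0S3W1-G0 CLAIM-3 + INTENT-3]`).
`--kind proof --supports stmt-QuantumFields-20541 --as helper`, COUNT-NEUTRAL.  NEW leaf; nothing modified; theorems only — 0 `def`, 0 `sorry`, no new named fact.  Over:
`Thm/…K0V19Defs` (p594829: V19's socket text 3ᴬ′ by name), k0-s3-w2's `Thm/…K0Stub3RunwiseFace` (p607023: the run face's generic lemmas by name), DEF-1's run letter `Thm/…K2NamedJetsRunRemAt` (p596574: `RunConstRemainder`, `RunConstRemainder.mono`), dag-n22-w3's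
`Thm/…N22KernelsBetaHistLipschitz` (`YMDAG.N22.AtKernels.histLipschitz_betaOfRecord₁₃_of_kernelNE9`, `fadingMemory_histModuli_of_fadingMemory`), t4's `T4CouplingMatching`
(`HistLipschitz`, `FadingMemory`), W1-19 `Node00/U3OfKernels` (`objectsOfRecord₁₃`, `KernelDecayOfRecord₁₃`), the tree's `FlowStep ∕ FlowStepRuns` ((0.20): `RGEqH`, `genSeq`,
`solveCoupling`).  [I] = [Balaban1987RG1]; [II] = [Balaban1989LargeFieldII]; [III] = [Balaban1988Convergent]; [15] = [Balaban1985Variational]; [RG2] = [Balaban1988RG2Cluster].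

WHY.  V19's registered stub 3ᴬ′ (`K0V19Defs.AbsBetaBoxAtThm1WitnessCCMGenAt F`) bounds β₁₃(θ₁₅ᶜᶜᴹ(j)) on the whole history BOX `]0, γ₀]^{k+1}`; its run face 3ᴿ (twin seat k0-s3-w2,
`Thm/…K0Stub3RunwiseFace`, p607023: `RunConstRemainder (betaOfRecord₁₃ F 2 (theta13OfThm1CCM …)) (fun _ => 0) β′ γ₀`) bounds it only along the in-window solutions of (0.20) — and
suffices for K0⁷ (that file) — with «3ᴬ′ ⟹ 3ᴿ» trivial.  THIS FILE proves the CONVERSE modulo letters the K3 side already carries at the same θ: N22's kernel-currency NE9 with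
node-U3 fading-memory moduli and the (D4) letter `U3OfKernels.KernelDecayOfRecord₁₃` (per-sequence constants — enough here) make β₁₃(θ) history-LIPSCHITZ on the box with
k-SUMMABLE moduli (dag-n22-w3, BY NAME); the run letter supplies, at every level `k`, ONE reference history in the box where |β| ≤ β′ — the prefix of an in-window run of length `k`,
which EXISTS because the run letter itself lets one build such runs from a small bare coupling (§1, induction on (0.20)); hence |β| ≤ β′ + γ₀·(sum of moduli) on the whole box.
So «re-cut stub 3 as 3ᴿ?» costs node O nothing extra once (D4) + NE9(fading) hold at the witness: the two sockets are then the SAME debt.  (w2's LOCATED-1: β₁₃(θ₁₅ᶜᶜᴹ(j)) is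
`rfl`-blind to `(j, ε₀, B₃, B₃′, a₁)` — consistent; everything here is θ-generic and reads the witness only through `.γ = ½`.)

CONTENTS (kernel-checked; CONDITIONAL — the run letter and every kernel letter DISPLAYED, inhabited nowhere).
§1 generic (`β : HBeta`; k0-s3-w2's `rgEqH_genSeq_of_inInterval` ∕ `nonneg_of_runConstRemainder_zero` BY NAME from p607023): ★ `exists_inInterval_genSeq_of_runConstRemainder_zero` ((i): runs of
   every length `n` in `]0, γ₀]` from `g₀ = (γ₀⁻² + (n+1)β′)^{−1/2}`).
§2 generic: `abs_sub_le_of_mem_box`, `abs_le_of_histLipschitz_of_ref` (one reference history in the box ⟹ |β(v)| ≤ |β(v⋆)| + γ₀·Σ_i Λ k i), `sum_histModuli_le_of_fadingMemory`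
   (`FadingMemory C ω Λ`, `0 ≤ ω < 1` ⟹ `Σ_i Λ k i ≤ C/(1−ω)`), ★ `absBetaBox_of_runConstRemainder_zero_of_histLipschitz` ((ii)).
§3 θ-generic at the record: `absBetaBox_betaOfRecord₁₃_of_run_of_histLipschitz` (run letter + node U2's `HistLipschitz` with fading memory — the K2-side currency), ★★ `absBetaBox_betaOfRecord₁₃_of_run_of_kernelNE9` (run letter + `0 < κ` + N22's NE9 of `(objectsOfRecord₁₃ F N θ ℓ).EA 0` on `Window θ.γ` + (D4)
   `KernelDecayOfRecord₁₃ F N θ 0 1 κ` + node-U3 `FadingMemory C₉ ω Λ`, `0 ≤ ω < 1` ⟹ the sign-free box on `]0, γ₀]`, bound `β′ + γ₀·(β′₅₁₀(1,κ)·C₉·ω∕(1−ω))`).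
§4 at A1's witness, (j, c)-generic prefix VERBATIM: ★★★ `abs3A'_of_run3R_of_kernelLettersAt : 3ᴿ(F) → (the K3∕N22 kernel letters at every member θ₁₅ᶜᶜᴹ(j; ε₀, ε₂₉; …) of the witness
   family) → K0V19Defs.AbsBetaBoxAtThm1WitnessCCMGenAt F`.
§5 sharpness: ★ `exists_hbeta_runLetter_not_box` — a bare `HBeta` meeting the run letter with `β′ = 0` on every window yet unbounded on every box: without regularity letters
   «3ᴿ ⟹ 3ᴬ′» FAILS, so the kernel letters of §3–§4 are doing real work.

HONEST FRAMING (binding).  Elementary real arithmetic on (0.20) and on Lipschitz sums + by-name composition over LANDED bookkeeping (dag-n22-w3's history-Lipschitz road, itself over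
t4∕pv10's dominated summation); NOTHING of Bałaban's analysis is asserted or proved: the run letter 3ᴿ (node O's wall read along runs, [I] Thm 3 p. 264 ∕ Thm 2 p. 259 — proof
unpublished, [II] p. 355), kernel-currency NE9 (NOT printed for d = 4), the (5.10) clause at the record and the fading-memory moduli are HYPOTHESES; 3ᴬ′ ∕ 3ᴿ NOT proved; K0⁷
stmt-QuantumFields-20541 OPEN (V19 87879403b3a26109 of record) and NOT claimed; no registry write; no count claim (typed 28∕28 · discharged 5∕27 unmoved); no summit statement is
proved by this seat; route R4 closes the CONDITIONAL finite-𝕋⁴ rung `BalabanLadder.UV` only — NOTHING about the continuum limit, ℝ⁴, OS axioms, a mass gap or the Clay problem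
is proved or claimed.  No `sorry`, `def`, `instance`, `notation`, `axiom`; standard axioms.
-/

noncomputable section

open scoped Matrix.Norms.L2Operator BigOperators
open Finset

namespace Summit.QuantumFields.YangMills.Theorems.K0Stub3RunFaceBoxEquivalence

open Literature.MathematicalPhysics.QuantumFieldTheory.Balaban1983to89
open Literature.MathematicalPhysics.QuantumFieldTheory.Balaban1983to89.Node00
open Literature.MathematicalPhysics.QuantumFieldTheory.Balaban1983to89.T4Continuum
open Literature.MathematicalPhysics.QuantumFieldTheory.Balaban1983to89.FlowStep
open Literature.MathematicalPhysics.QuantumFieldTheory.Balaban1983to89.FlowStepRuns (genSeq genSeq_zero genSeq_succ solveCoupling solveCoupling_pos inv_sq_solveCoupling)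
open Literature.MathematicalPhysics.QuantumFieldTheory.Balaban1983to89.T4OutputRate (Window NE9)
open Literature.MathematicalPhysics.QuantumFieldTheory.Balaban1983to89.T4CouplingMatching (HistLipschitz)
open Literature.MathematicalPhysics.QuantumFieldTheory.Balaban1983to89.B12Sec2to5 (betaPrime510)
open Literature.MathematicalPhysics.QuantumFieldTheory.Balaban1983to89.Node00.U3OfKernels (objectsOfRecord₁₃ KernelDecayOfRecord₁₃)
open Summit.QuantumFields.YangMills.Theorems.K0V19Defs (AbsBetaBoxAtThm1WitnessCCMGenAt)
open Summit.QuantumFields.YangMills.Theorems.BalabanUVNodesK2NamedJetsRunRemAt (RunConstRemainder)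
open YMDAG.N22.AtKernels (histLipschitz_betaOfRecord₁₃_of_kernelNE9 fadingMemory_histModuli_of_fadingMemory)
open Summit.QuantumFields.YangMills.Theorems.K0Stub3RunwiseFace (rgEqH_genSeq_of_inInterval nonneg_of_runConstRemainder_zero)

/-! ## §1  Generic (0.20) arithmetic: the run letter `RunConstRemainder β 0 β′ γ₀` lets one BUILD in-window runs of every length -/

section Runs

variable {β : HBeta}

/-- **★ (i) THE RUN LETTER FORCES IN-WINDOW RUNS OF EVERY LENGTH**: if `|β_{k+1}(g₀,…,g_k)| ≤ β′` at every prefix `k ≤ n` of every solution of (0.20) up to `n` staying in `]0, γ₀]`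
(`RunConstRemainder β 0 β′ γ₀`, `γ₀ > 0`), then for every `n` the run generated from the bare coupling `g₀` with `g₀⁻² = γ₀⁻² + (n+1)·β′` stays in `]0, γ₀]` up to `n`: by
induction on (0.20), `g_m⁻² ≥ γ₀⁻² + (n+1−m)·β′` — the β read at step `m` is the β of the run built so far, which the letter bounds. [cite: Balaban1987RG1, (0.18)–(0.20) pp.255–256, Thm 3 p.264] -/
theorem exists_inInterval_genSeq_of_runConstRemainder_zero {β' γ₀ : ℝ} (h : RunConstRemainder β (fun _ => 0) β' γ₀) (hγ₀ : 0 < γ₀) (n : ℕ) :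
    ∃ g0 : ℝ, Step.InInterval γ₀ n (genSeq β g0) := by
  have hβ' : 0 ≤ β' := nonneg_of_runConstRemainder_zero hγ₀ h
  set T : ℝ := 1 / γ₀ ^ 2 + ((n : ℝ) + 1) * β' with hT
  have hγsq : 0 < 1 / γ₀ ^ 2 := by positivity
  have hTpos : 0 < T := by positivity
  refine ⟨solveCoupling T, ?_⟩
  set g : ℕ → ℝ := genSeq β (solveCoupling T) with hg
  -- invariant: in the window up to `m` and `1/g_m² ≥ 1/γ₀² + (n+1−m)·β′`
  have key : ∀ m, m ≤ n → Step.InInterval γ₀ m g ∧ 1 / γ₀ ^ 2 + ((n : ℝ) + 1 - m) * β' ≤ 1 / (g m) ^ 2 := by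
    intro m
    induction m with
    | zero =>
      intro _
      have hg0 : g 0 = solveCoupling T := by rw [hg, genSeq_zero]
      have hpos : 0 < g 0 := by rw [hg0]; exact solveCoupling_pos hTpos
      have hinv : 1 / (g 0) ^ 2 = T := by rw [hg0]; exact inv_sq_solveCoupling hTpos
      have hle : g 0 ≤ γ₀ := by
        -- `1/γ₀² ≤ 1/g₀²` ⟹ `g₀ ≤ γ₀` (the tree's `le_of_one_div_sq_le'` pattern, inlined)
        refine (pow_le_pow_iff_left₀ hpos.le hγ₀.le two_ne_zero).1 ((one_div_le_one_div (pow_pos hγ₀ 2) (pow_pos hpos 2)).1 ?_)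
        rw [hinv, hT]
        nlinarith
      refine ⟨fun k hk => ?_, ?_⟩
      · obtain rfl : k = 0 := Nat.le_zero.mp hk
        exact ⟨hpos, hle⟩
      · rw [hinv, hT]; push_cast; nlinarith
    | succ m ih =>
      intro hm1
      obtain ⟨hIm, hinvm⟩ := ih (Nat.le_of_succ_le hm1)
      have hgm : 0 < g m := (hIm m le_rfl).1
      have hrg : RGEqH m β g := rgEqH_genSeq_of_inInterval hIm
      have hβm : |β m (prefixOf g m)| ≤ β' := by simpa using h m g hrg hIm m le_rfl
      have hβm' := (abs_le.mp hβm).2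
      set y : ℝ := 1 / (g m) ^ 2 - β m (prefixOf g m) with hy
      have hmn : (m : ℝ) + 1 ≤ n := by exact_mod_cast hm1
      have hylow : 1 / γ₀ ^ 2 + ((n : ℝ) + 1 - (m + 1 : ℕ)) * β' ≤ y := by
        rw [hy]; push_cast; nlinarith
      have hyγ : 1 / γ₀ ^ 2 ≤ y := by
        have : 0 ≤ ((n : ℝ) + 1 - (m + 1 : ℕ)) * β' := by push_cast; nlinarith
        linarith
      have hypos : 0 < y := lt_of_lt_of_le hγsq hyγ
      have hsucc : g (m + 1) = solveCoupling y := by rw [hg, genSeq_succ]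
      have hpos1 : 0 < g (m + 1) := by rw [hsucc]; exact solveCoupling_pos hypos
      have hinv1 : 1 / (g (m + 1)) ^ 2 = y := by rw [hsucc]; exact inv_sq_solveCoupling hypos
      have hle1 : g (m + 1) ≤ γ₀ :=
        (pow_le_pow_iff_left₀ hpos1.le hγ₀.le two_ne_zero).1 ((one_div_le_one_div (pow_pos hγ₀ 2) (pow_pos hpos1 2)).1 (by rw [hinv1]; exact hyγ))
      refine ⟨fun k hk => ?_, by rw [hinv1]; exact hylow⟩
      rcases Nat.lt_or_ge k (m + 1) with hlt | hge
      · exact hIm k (Nat.lt_succ_iff.mp hlt)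
      · obtain rfl : k = m + 1 := le_antisymm hk hge
        exact ⟨hpos1, hle1⟩
  exact (key n le_rfl).1

end Runs

/-! ## §2  Generic: one reference history in the box + history-Lipschitz moduli with summable rows ⟹ the box bound; the run letter supplies the references -/

section Box

variable {β : HBeta}

/-- Two points of `]0, γ₀]` are within `γ₀` of each other. [folklore] -/
theorem abs_sub_le_of_mem_box {γ₀ : ℝ} {k : ℕ} {v w : Fin (k + 1) → ℝ} (hv : v ∈ Box γ₀ k) (hw : w ∈ Box γ₀ k) (i : Fin (k + 1)) :
    |v i - w i| ≤ γ₀ := by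
  have h1 := mem_box.mp hv i
  have h2 := mem_box.mp hw i
  rw [abs_sub_le_iff]
  constructor <;> linarith

/-- **ONE REFERENCE HISTORY SUFFICES UNDER HISTORY-LIPSCHITZ MODULI**: `HistLipschitz Λ γ β`, `γ₀ ≤ γ`, non-negative moduli on the rows `i ≤ k`, `v, v⋆ ∈ ]0, γ₀]^{k+1}` ⟹
`|β_k(v)| ≤ |β_k(v⋆)| + γ₀ · Σ_i Λ k i`. [cite: Balaban1987RG1, §1 p.264 (bookkeeping on the β-clause «uniformly bounded … with all derivatives»)] -/
theorem abs_le_of_histLipschitz_of_ref {Λ : ℕ → ℕ → ℝ} {γ γ₀ : ℝ} (hL : HistLipschitz Λ γ β) (hle : γ₀ ≤ γ) (hΛ : ∀ (k : ℕ) (i : Fin (k + 1)), 0 ≤ Λ k i)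
    {k : ℕ} {v w : Fin (k + 1) → ℝ} (hv : v ∈ Box γ₀ k) (hw : w ∈ Box γ₀ k) :
    |β k v| ≤ |β k w| + γ₀ * ∑ i : Fin (k + 1), Λ k i := by
  have hdiff : |β k v - β k w| ≤ ∑ i : Fin (k + 1), Λ k i * |v i - w i| := hL k v w (box_mono hle k hv) (box_mono hle k hw)
  have hsum : ∑ i : Fin (k + 1), Λ k i * |v i - w i| ≤ ∑ i : Fin (k + 1), Λ k i * γ₀ :=
    Finset.sum_le_sum fun i _ => mul_le_mul_of_nonneg_left (abs_sub_le_of_mem_box hv hw i) (hΛ k i)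
  have hsum' : ∑ i : Fin (k + 1), Λ k i * γ₀ = γ₀ * ∑ i : Fin (k + 1), Λ k i := by rw [Finset.mul_sum]; exact Finset.sum_congr rfl fun i _ => mul_comm _ _
  have htri : |β k v| ≤ |β k w| + |β k v - β k w| := by
    have := abs_add_le (β k w) (β k v - β k w)
    rwa [add_sub_cancel] at this
  linarith

/-- **FADING MEMORY ⟹ k-SUMMABLE ROWS**: `0 ≤ Λ k i ≤ C·ω^{k−i}` (`i ≤ k`; t4's `T4CouplingMatching.FadingMemory C ω Λ`) with `0 ≤ ω < 1` ⟹ `Σ_{i ≤ k} Λ k i ≤ C/(1−ω)` for every `k`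
(geometric series; `C ≥ 0` is forced at `i = k`). [folklore] -/
theorem sum_histModuli_le_of_fadingMemory {C ω : ℝ} {Λ : ℕ → ℕ → ℝ} (h : T4CouplingMatching.FadingMemory C ω Λ) (hω0 : 0 ≤ ω) (hω1 : ω < 1) (k : ℕ) :
    ∑ i : Fin (k + 1), Λ k i ≤ C / (1 - ω) := by
  have hC : 0 ≤ C := by have := h k k le_rfl; simpa using this.1.trans this.2
  have h1 : ∑ i : Fin (k + 1), Λ k i ≤ ∑ i : Fin (k + 1), C * ω ^ (k - (i : ℕ)) :=
    Finset.sum_le_sum fun i _ => (h k i (Nat.lt_succ_iff.mp i.isLt)).2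
  have h2 : ∑ i : Fin (k + 1), C * ω ^ (k - (i : ℕ)) = C * ∑ j ∈ range (k + 1), ω ^ j := by
    rw [← Finset.mul_sum, Fin.sum_univ_eq_sum_range (fun i => ω ^ (k - i)) (k + 1), ← Finset.sum_range_reflect (fun j => ω ^ j) (k + 1)]
    congr 1
  have h3 : ∑ j ∈ range (k + 1), ω ^ j ≤ 1 / (1 - ω) := by
    have := geom_sum_Ico_le_of_lt_one (m := 0) (n := k + 1) hω0 hω1
    rw [pow_zero, ← Finset.range_eq_Ico] at this
    exact this
  calc ∑ i : Fin (k + 1), Λ k i ≤ C * ∑ j ∈ range (k + 1), ω ^ j := h1.trans_eq h2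
    _ ≤ C * (1 / (1 - ω)) := mul_le_mul_of_nonneg_left h3 hC
    _ = C / (1 - ω) := by ring

/-- **★ (ii) THE SIGN-FREE BOX FROM THE RUN LETTER AND HISTORY-LIPSCHITZ MODULI WITH k-SUMMABLE ROWS**: `RunConstRemainder β 0 β′ γ₀` (`γ₀ > 0`), `HistLipschitz Λ γ β` on a box side
`γ ≥ γ₀` with `0 ≤ Λ k i` (`i ≤ k`), `Σ_{i≤k} Λ k i ≤ S` for all `k` ⟹ `BetaLowerH (−(β′ + γ₀·S)) γ₀ β ∧ BetaUpperH (β′ + γ₀·S) γ₀ β`.  At level `k` the reference history is the prefix of an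
in-window run of length `k` (§1 (i)), where the run letter gives |β| ≤ β′; every other box history is within `γ₀` coordinatewise. [cite: Balaban1987RG1, Thm 3 p.264, §1 p.264 (bookkeeping)] -/
theorem absBetaBox_of_runConstRemainder_zero_of_histLipschitz {Λ : ℕ → ℕ → ℝ} {β' γ₀ γ S : ℝ} (hrun : RunConstRemainder β (fun _ => 0) β' γ₀) (hγ₀ : 0 < γ₀)
    (hle : γ₀ ≤ γ) (hL : HistLipschitz Λ γ β) (hΛ : ∀ (k : ℕ) (i : Fin (k + 1)), 0 ≤ Λ k i) (hS : ∀ k, ∑ i : Fin (k + 1), Λ k i ≤ S) :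
    BetaLowerH (-(β' + γ₀ * S)) γ₀ β ∧ BetaUpperH (β' + γ₀ * S) γ₀ β := by
  have key : ∀ (k : ℕ) (v : Fin (k + 1) → ℝ), v ∈ Box γ₀ k → |β k v| ≤ β' + γ₀ * S := by
    intro k v hv
    obtain ⟨g0, hI⟩ := exists_inInterval_genSeq_of_runConstRemainder_zero hrun hγ₀ k
    have hw : prefixOf (genSeq β g0) k ∈ Box γ₀ k := mem_box.mpr fun i => hI i (Nat.lt_succ_iff.mp i.isLt)
    have href : |β k (prefixOf (genSeq β g0) k)| ≤ β' := by simpa using hrun k _ (rgEqH_genSeq_of_inInterval hI) hI k le_rfl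
    have h1 := abs_le_of_histLipschitz_of_ref hL hle hΛ hv hw
    have h2 : γ₀ * ∑ i : Fin (k + 1), Λ k i ≤ γ₀ * S := mul_le_mul_of_nonneg_left (hS k) hγ₀.le
    linarith
  exact ⟨fun k v hv => (abs_le.mp (key k v hv)).1, fun k v hv => (abs_le.mp (key k v hv)).2⟩

end Box

/-! ## §3  θ-generic at the record: the run letter + N22's kernel NE9 (fading memory) + the (D4) letter ⟹ the sign-free BOX of `betaOfRecord₁₃ θ` (dag-n22-w3's road BY NAME) -/

section Record

variable (F : T4Family) (N : ℕ) [NeZero N]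

/-- **(iii₀) THE SIGN-FREE BOX OF THE β OF RECORD FROM ITS RUN LETTER AND node U2's HISTORY-MODULI LETTER WITH FADING MEMORY** (any `θ`, `0 < γ₀ ≤ θ.γ`): the K2-side
currency — `HistLipschitz Λ′ θ.γ (betaOfRecord₁₃ θ)` with `T4CouplingMatching.FadingMemory C ω Λ′`, `0 ≤ ω < 1` (the second ∕ third conjuncts of the tree's `U2Inputs` at a datum whose β is
the record's) — plus the run letter give the box with bound `β′ + γ₀·C∕(1−ω)`.  CONDITIONAL; nothing asserted. [cite: Balaban1987RG1, §1 p.264, Thm 3 p.264 (bookkeeping)] -/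
theorem absBetaBox_betaOfRecord₁₃_of_run_of_histLipschitz (θ : Stage13Params F N) {C ω β' γ₀ : ℝ} {Λ' : ℕ → ℕ → ℝ}
    (hL : HistLipschitz Λ' θ.γ (betaOfRecord₁₃ F N θ)) (hΛ : T4CouplingMatching.FadingMemory C ω Λ') (hω0 : 0 ≤ ω) (hω1 : ω < 1) (hγ₀ : 0 < γ₀) (hle : γ₀ ≤ θ.γ)
    (hrun : RunConstRemainder (betaOfRecord₁₃ F N θ) (fun _ => 0) β' γ₀) :
    BetaLowerH (-(β' + γ₀ * (C / (1 - ω)))) γ₀ (betaOfRecord₁₃ F N θ) ∧ BetaUpperH (β' + γ₀ * (C / (1 - ω))) γ₀ (betaOfRecord₁₃ F N θ) :=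
  absBetaBox_of_runConstRemainder_zero_of_histLipschitz hrun hγ₀ hle hL (fun k i => (hΛ k i (Nat.lt_succ_iff.mp i.isLt)).1)
    (sum_histModuli_le_of_fadingMemory hΛ hω0 hω1)

/-- **★★ (iii) THE SIGN-FREE BOX OF THE β OF RECORD FROM ITS RUN LETTER AND THE K3∕N22 KERNEL LETTERS** (any `θ : Stage13Params F N`, window `0 < γ₀ ≤ θ.γ`): N22's kernel-currency
NE9 of the functional of record with moduli `Λ` having node-U3 fading memory `FadingMemory C₉ ω Λ` (`0 ≤ ω < 1`), the (D4) letter `KernelDecayOfRecord₁₃ F N θ 0 1 κ` (`0 < κ`;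
per-sequence constants) — whence `HistLipschitz (β′₅₁₀(1,κ)·Λ (k+1) i) θ.γ (betaOfRecord₁₃ θ)` (dag-n22-w3 `histLipschitz_betaOfRecord₁₃_of_kernelNE9`) with rows summing to
`≤ β′₅₁₀(1,κ)·C₉·ω∕(1−ω)` — and the RUN letter `RunConstRemainder (betaOfRecord₁₃ θ) 0 β′ γ₀` give `−B ≤ β₁₃(θ) ≤ B` on `]0, γ₀]^{k+1}`, all `k`, with
`B = β′ + γ₀·(β′₅₁₀(1,κ)·C₉·ω∕(1−ω))`.  CONDITIONAL on the three displayed letters; nothing of Bałaban asserted. [cite: Balaban1987RG1, (1.20)–(1.22) p.264, §1 p.264, (5.10) p.293, Thm 3 p.264; Balaban1988RG2Cluster, (2.13)–(2.14) pp.14–15] -/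
theorem absBetaBox_betaOfRecord₁₃_of_run_of_kernelNE9 (θ : Stage13Params F N) (ℓ : U3Letters₁₁) {κ C₉ ω β' γ₀ : ℝ} {Λ : ℕ → ℕ → ℝ} (hκ : 0 < κ)
    (h9 : NE9 ((objectsOfRecord₁₃ F N θ ℓ).EA 0) (Window θ.γ) κ Λ) (hdec : KernelDecayOfRecord₁₃ F N θ 0 1 κ)
    (hΛ : T4OutputRate.FadingMemory C₉ ω Λ) (hω0 : 0 ≤ ω) (hω1 : ω < 1) (hγ₀ : 0 < γ₀) (hle : γ₀ ≤ θ.γ)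
    (hrun : RunConstRemainder (betaOfRecord₁₃ F N θ) (fun _ => 0) β' γ₀) :
    BetaLowerH (-(β' + γ₀ * (betaPrime510 4 1 κ * C₉ * ω / (1 - ω)))) γ₀ (betaOfRecord₁₃ F N θ) ∧
      BetaUpperH (β' + γ₀ * (betaPrime510 4 1 κ * C₉ * ω / (1 - ω))) γ₀ (betaOfRecord₁₃ F N θ) := by
  have hL := histLipschitz_betaOfRecord₁₃_of_kernelNE9 F N θ ℓ hκ h9 hdec
  -- `0 ≤ β′₅₁₀(1, κ)` (a `tsum` of non-negative terms; the tree's `YMDAG.N18.RemainderBandOfKernelLetters.betaPrime510_four_one_nonneg`, inlined to keep the import cone small)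
  have hP : 0 ≤ betaPrime510 4 1 κ := by
    unfold betaPrime510
    rw [one_mul]
    exact tsum_nonneg fun x => mul_nonneg (sq_nonneg _) (Real.exp_nonneg _)
  have hFM := fadingMemory_histModuli_of_fadingMemory hP hΛ
  exact absBetaBox_of_runConstRemainder_zero_of_histLipschitz hrun hγ₀ hle hL (fun k i => (hFM k i (Nat.lt_succ_iff.mp i.isLt)).1)
    (sum_histModuli_le_of_fadingMemory hFM hω0 hω1)

end Record

/-! ## §4  At A1's collared witness `θ₁₅ᶜᶜᴹ(j)` (`.γ = ½`), (j, c)-generic: 3ᴿ(F) + the kernel letters at the witness family ⟹ V19's socket 3ᴬ′(F) BY NAME -/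

section Witness

/-- **★★★ THE CONVERSE OF «3ᴬ′ ⟹ 3ᴿ» MODULO THE K3∕N22 KERNEL LETTERS AT THE WITNESS**: the run face 3ᴿ(F) (k0-s3-w2's text: V19's (j, c)-generic prefix VERBATIM, then
`∃ γ₀ ε₀ ε₂₉ β′, … ∧ RunConstRemainder (β₁₃(θ₁₅ᶜᶜᴹ(j; ε₀, ε₂₉; B₃, B₃′, a₀, a₁))) 0 β′ γ₀`), together with — at EVERY member of the witness family (all `j`, thresholds `ε₀, ε₂₉ > 0` and
constants) — SOME letter block `ℓ`, rate `κ > 0`, moduli `Λ` with node-U3 fading memory `(C₉, ω)`, `0 ≤ ω < 1`, carrying N22's kernel NE9 on `Window ½` and the (D4) letter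
`KernelDecayOfRecord₁₃ … 0 1 κ`, gives V19's REGISTERED socket text `K0V19Defs.AbsBetaBoxAtThm1WitnessCCMGenAt F` (window `min γ₀ ½`, §3).  So under the kernel letters the run
face and the box socket are ONE debt.  CONDITIONAL on 3ᴿ and on the letters (node O's ∕ the K3 side's — inhabited nowhere here); stub 3ᴬ′ NOT proved; K0⁷ OPEN.
[cite: Balaban1987RG1, Thm 1 p.259, (1.20)–(1.22) p.264, §1 p.264, Thm 3 p.264, (5.10) p.293; Balaban1985Variational, Thm 1 p.279, Prop. 8 p.304; Balaban1988Convergent, Thm 1 p.262] -/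
theorem abs3A'_of_run3R_of_kernelLettersAt (F : T4Family)
    (h3R : ∀ (j c : ℕ) (B₃ B₃' a₀ a₁ : ℝ), c ≤ F.L ^ j → 2 * (F.L : ℝ) ^ 2 ≤ B₃ → 0 < B₃' → 0 < a₀ → 0 < a₁ →
      VariationalThm1RegSepCoP7M F 2 B₃ a₀ a₁ →
      Gauge9RegSepTopStepR F 2 (fun ν K Ω => suppDomOfRecord F ν K Ω) (F.L ^ j) c B₃ B₃' a₀ a₁ →
      ∃ γ₀ ε₀ ε₂₉ β' : ℝ, 0 < γ₀ ∧ 0 < ε₀ ∧ 0 < ε₂₉ ∧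
        RunConstRemainder (betaOfRecord₁₃ F 2 (theta13OfThm1CCM F 2 j ε₀ ε₂₉ B₃ B₃' a₀ a₁)) (fun _ => 0) β' γ₀)
    (hK : ∀ (j : ℕ) (ε₀ ε₂₉ B₃ B₃' a₀ a₁ : ℝ), 0 < ε₀ → 0 < ε₂₉ →
      ∃ (ℓ : U3Letters₁₁) (κ C₉ ω : ℝ) (Λ : ℕ → ℕ → ℝ), 0 < κ ∧ 0 ≤ ω ∧ ω < 1 ∧
        NE9 ((objectsOfRecord₁₃ F 2 (theta13OfThm1CCM F 2 j ε₀ ε₂₉ B₃ B₃' a₀ a₁) ℓ).EA 0) (Window (theta13OfThm1CCM F 2 j ε₀ ε₂₉ B₃ B₃' a₀ a₁).γ) κ Λ ∧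
        KernelDecayOfRecord₁₃ F 2 (theta13OfThm1CCM F 2 j ε₀ ε₂₉ B₃ B₃' a₀ a₁) 0 1 κ ∧
        T4OutputRate.FadingMemory C₉ ω Λ) :
    AbsBetaBoxAtThm1WitnessCCMGenAt F := by
  intro j c B₃ B₃' a₀ a₁ hc hB hB' ha₀ ha₁ h15 h9
  obtain ⟨γ₀, ε₀, ε₂₉, β', hγ₀, hε, hε', hrun⟩ := h3R j c B₃ B₃' a₀ a₁ hc hB hB' ha₀ ha₁ h15 h9
  obtain ⟨ℓ, κ, C₉, ω, Λ, hκ, hω0, hω1, h9', hdec, hΛ⟩ := hK j ε₀ ε₂₉ B₃ B₃' a₀ a₁ hε hε'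
  set γ₁ : ℝ := min γ₀ (1 / 2) with hγ₁
  have hγ₁pos : 0 < γ₁ := lt_min hγ₀ (by norm_num)
  have hγ₁le : γ₁ ≤ (theta13OfThm1CCM F 2 j ε₀ ε₂₉ B₃ B₃' a₀ a₁).γ := by rw [theta13OfThm1CCM_γ]; exact min_le_right _ _
  have hrun₁ : RunConstRemainder (betaOfRecord₁₃ F 2 (theta13OfThm1CCM F 2 j ε₀ ε₂₉ B₃ B₃' a₀ a₁)) (fun _ => 0) β' γ₁ := hrun.mono (min_le_left _ _)
  obtain ⟨hlow, hup⟩ := absBetaBox_betaOfRecord₁₃_of_run_of_kernelNE9 F 2 _ ℓ hκ h9' hdec hΛ hω0 hω1 hγ₁pos hγ₁le hrun₁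
  exact ⟨γ₁, ε₀, ε₂₉, _, hγ₁pos, hε, hε', hlow, hup⟩

end Witness

/-! ## §5  … AND NOT WITHOUT LETTERS: a history family bounded (by `0`) along every in-window run of (0.20) yet unbounded on every box — the converse NEEDS regularity -/

section Sharpness

/-- **★ THE RUN FACE IS STRICTLY WEAKER THAN THE BOX IN GENERAL** (generic `HBeta`; no kernel letters): the family `β₁ ≡ 0`, `β₂(g₀, g₁) = |g₁ − g₀|⁻¹` (Lean's `0⁻¹ = 0`), `β_k ≡ 0`
(`k ≥ 3`) satisfies the run letter with `β′ = 0` on EVERY window — along a solution of (0.20) `g₁ = g₀` exactly, where `β₂` vanishes — but `β₂` is unbounded above on every box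
`]0, γ₀]²`.  So «3ᴿ ⟹ 3ᴬ′» is false for a bare `HBeta`; §2–§4 buy it with history-Lipschitz moduli (N22's NE9 + (D4) at the record).  Elementary; nothing about Bałaban's β.
[cite: Balaban1987RG1, (0.20) p.256, Thm 3 p.264 (bookkeeping)] -/
theorem exists_hbeta_runLetter_not_box :
    ∃ β : HBeta, (∀ γ₀ : ℝ, RunConstRemainder β (fun _ => 0) 0 γ₀) ∧ ∀ γ₀ B : ℝ, 0 < γ₀ → ¬ BetaUpperH B γ₀ β := by
  refine ⟨fun k v => if h : k = 1 then |v ⟨1, by omega⟩ - v ⟨0, by omega⟩|⁻¹ else 0, ?_, ?_⟩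
  · intro γ₀ n gs hrg hI k hk
    rw [sub_zero]
    by_cases h1 : k = 1
    · subst h1
      have h0 := hrg 0 (by omega)
      simp only [zero_add, Nat.zero_ne_one, ↓reduceDIte, add_zero] at h0
      have hg0 := (hI 0 (by omega)).1
      have hg1 := (hI 1 hk).1
      have hsq : gs 0 ^ 2 = gs 1 ^ 2 := by
        have h0' : (gs 0 ^ 2)⁻¹ = (gs 1 ^ 2)⁻¹ := by simpa [one_div] using h0
        exact inv_inj.mp h0'
      have heq : gs 0 = gs 1 := (pow_left_inj₀ hg0.le hg1.le two_ne_zero).mp hsq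
      simp [prefixOf, heq]
    · simp [h1]
  · intro γ₀ B hγ₀ hup
    set δ : ℝ := min (γ₀ / 2) (1 / (|B| + 1)) with hδ
    have hB1 : 0 < |B| + 1 := by positivity
    have hδpos : 0 < δ := lt_min (by positivity) (by positivity)
    have hδle : δ ≤ γ₀ / 2 := min_le_left _ _
    have hδle' : δ ≤ 1 / (|B| + 1) := min_le_right _ _
    -- the level-1 box history `(γ₀, γ₀ − δ)`
    have hvbox : (fun i : Fin (1 + 1) => γ₀ - δ * (i : ℕ)) ∈ Box γ₀ 1 := by
      refine mem_box.mpr fun i => ?_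
      have hi : ((i : ℕ) : ℝ) ≤ 1 := by exact_mod_cast Nat.lt_succ_iff.mp i.isLt
      have hi0 : (0 : ℝ) ≤ ((i : ℕ) : ℝ) := by exact_mod_cast Nat.zero_le _
      constructor <;> nlinarith
    have hval := hup 1 _ hvbox
    have h10 : (fun i : Fin (1 + 1) => γ₀ - δ * (i : ℕ)) ⟨1, by omega⟩ - (fun i : Fin (1 + 1) => γ₀ - δ * (i : ℕ)) ⟨0, by omega⟩ = -δ := by
      push_cast
      ring
    simp only [↓reduceDIte] at hval
    rw [h10, abs_neg, abs_of_pos hδpos] at hval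
    -- `δ⁻¹ ≥ |B| + 1 > B`
    have hinv : |B| + 1 ≤ δ⁻¹ := by
      rw [le_inv_comm₀ hB1 hδpos]
      simpa [one_div] using hδle'
    have : B < δ⁻¹ := lt_of_lt_of_le (lt_of_le_of_lt (le_abs_self B) (lt_add_one _)) hinv
    linarith

end Sharpness

end Summit.QuantumFields.YangMills.Theorems.K0Stub3RunFaceBoxEquivalence

end
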